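import Summits.ResolutionOfSingularities.ResolutionOfSingularities.Theorems.WildConesClassicalRegimesDefs
import Summits.ResolutionOfSingularities.ResolutionOfSingularities.Theorems.WildConesClassicalRegimesStubMuDropCurve

/-!
# Route `JacobianBudget`, crux `IsolatedJacobianDrop` (stmt-ResolutionOfSingularities-18946), line
# `euler-noether`: stub `stub_singleStepN1` (S7) — the curve case `n = 1` of the one-step
# Jacobian-colength drop

For a prime `p`, a field `κ` of characteristic `p`, and a one-variable coefficient function
`c : (Fin 1 → ℕ) → κ` of the height-one atom `z ^ p = a(u)`, `a = Σ c(k) u^k`, we show that one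
point-blow-up step lowers the Jacobian colength `μ = dim_κ κ[[u]] ⧸ (∂a/∂u)` by exactly `p`:
`μ(step c) + p = μ(c)` (so in particular `μ(step c) + p ≤ μ(c)`, the registered stub; the crux's
`Δ_1(p) = p` is attained).

The argument is the colength computation of the landed sibling theorem
`WildCones.stub_muDropCurve` (`Theorems/WildConesClassicalRegimesStubMuDropCurve.lean`), whose
`n = 1` kit (`MuDropCurve.ord_spec`, `jac_one`, `finrank_quot_span_pd`, `clean_step`, `step_apply`)
we reuse: in one variable the blow-up chart and the translation are identities, and under `MultP c`
the cleaned series `f = Σ f_k u^k` has order `m` with `p ≤ m`, `p ∤ m` (so `m ≥ p + 1`); its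
derivative has exact order `m - 1` with leading coefficient `m · f_m ≠ 0` (`CharP κ p`, `p ∤ m`), so
`μ(c) = m - 1` (`mu_eq`); the successor is `f / u ^ p`, of order `m - p` with `p ∤ m - p`, so
`μ(step c) = m - p - 1` (`mu_step_eq`). Hence `μ(step c) + p = m - 1 = μ(c)` (`mu_step_add_eq`).
Only `MultP c` is used; the isolatedness hypotheses and `MultP (step c)` are not needed.

Sources: folklore (Milnor number of `z ^ p + a(u)` in characteristic `p`); pattern copied from
`WildCones.stub_muDropCurve`.
-/

noncomputable section

set_option linter.dupNamespace false

open scoped BigOperators Classical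

open Summit.ResolutionOfSingularities.ResolutionOfSingularities.Theorems.WildCones
  (clean bl ord dv tr step run ser pd jac Isol MultP mu)

namespace Summit.ResolutionOfSingularities.ResolutionOfSingularities.Theorems.JacobianBudget

namespace SingleStepN1

open Summit.ResolutionOfSingularities.ResolutionOfSingularities.Theorems.WildCones.MuDropCurve

variable {p : ℕ} {κ : Type} [Field κ]

/-- Under `MultP c` (one variable), the cleaned order `m` satisfies `p < m`: `p ≤ m` by `MultP` and
`m ≠ p` since `p ∤ m`. [folklore] -/
theorem lt_ord {c : (Fin 1 → ℕ) → κ} (hM : MultP p 1 κ c) : p < ord 1 κ (clean p 1 κ c) := by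
  obtain ⟨-, -, hple, hpm⟩ := ord_spec hM
  exact lt_of_le_of_ne hple (fun h => hpm (h ▸ dvd_refl p))

/-- **`μ(c) = m - 1`**, `m` the cleaned order: under `MultP c` the derivative of the cleaned series
has exact order `m - 1` (leading coefficient `m · f_m ≠ 0` as `p ∤ m` in characteristic `p`).
Copied from the proof of `WildCones.stub_muDropCurve`. [folklore] -/
theorem mu_eq [CharP κ p] {c : (Fin 1 → ℕ) → κ} (hM : MultP p 1 κ c) :
    mu p 1 κ c = ord 1 κ (clean p 1 κ c) - 1 := by
  obtain ⟨hA₁, hmin', -, hpm⟩ := ord_spec hM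
  generalize ord 1 κ (clean p 1 κ c) = m at hA₁ hmin' hpm
  have hmκ : (m : κ) ≠ 0 := fun h => hpm ((CharP.cast_eq_zero_iff κ p m).mp h)
  have h1 : 1 ≤ m := Nat.pos_of_ne_zero (fun h => hpm (h ▸ dvd_zero p))
  show Module.finrank κ (MvPowerSeries (Fin 1) κ ⧸ jac p 1 κ c) = m - 1
  rw [jac_one]
  refine finrank_quot_span_pd _ m h1 ?_ ?_
  · intro A hA
    show clean p 1 κ c ⇑A = 0
    by_contra hne
    exact absurd (hmin' _ hne) (not_le.mpr hA)
  · show (m : κ) * clean p 1 κ c ⇑(Finsupp.single (0 : Fin 1) m) ≠ 0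
    have e : (⇑(Finsupp.single (0 : Fin 1) m) : Fin 1 → ℕ) = fun _ => m :=
      funext fun j => by rw [Fin.fin_one_eq_zero j, Finsupp.single_eq_same]
    rw [e]
    exact mul_ne_zero hmκ hA₁

/-- **`μ(step c) = m - p - 1`**, `m` the cleaned order of `c`: under `MultP c` the successor is the
cleaned series divided by `u ^ p` (`MuDropCurve.step_apply`), of order `m - p` with `p ∤ m - p`.
Copied from the proof of `WildCones.stub_muDropCurve`. [folklore] -/
theorem mu_step_eq [CharP κ p] {c : (Fin 1 → ℕ) → κ} (hM : MultP p 1 κ c) (i : Fin 1)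
    (τ : Fin 1 → κ) : mu p 1 κ (step p 1 κ i τ c) = ord 1 κ (clean p 1 κ c) - p - 1 := by
  obtain ⟨hA₁, hmin', hple, hpm⟩ := ord_spec hM
  generalize ord 1 κ (clean p 1 κ c) = m at hA₁ hmin' hple hpm
  have hlt : p < m := lt_of_le_of_ne hple (fun h => hpm (h ▸ dvd_refl p))
  have hmpκ : ((m - p : ℕ) : κ) ≠ 0 := fun h => hpm (by
    have h' := dvd_add ((CharP.cast_eq_zero_iff κ p (m - p)).mp h) (dvd_refl p)
    rwa [Nat.sub_add_cancel hple] at h')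
  show Module.finrank κ (MvPowerSeries (Fin 1) κ ⧸ jac p 1 κ (step p 1 κ i τ c)) = m - p - 1
  rw [jac_one]
  refine finrank_quot_span_pd _ (m - p) (by omega) ?_ ?_
  · intro A hA
    show clean p 1 κ (step p 1 κ i τ c) ⇑A = 0
    rw [clean_step, step_apply hM]
    by_contra hne
    have h := hmin' _ hne
    omega
  · show ((m - p : ℕ) : κ) *
      clean p 1 κ (step p 1 κ i τ c) ⇑(Finsupp.single (0 : Fin 1) (m - p)) ≠ 0
    rw [clean_step, step_apply hM, Finsupp.single_eq_same, Nat.sub_add_cancel hple]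
    exact mul_ne_zero hmpκ hA₁

/-- **The curve case is tight**: `μ(step c) + p = μ(c)` under `MultP c` in characteristic `p`
(one variable). [folklore] -/
theorem mu_step_add_eq [CharP κ p] {c : (Fin 1 → ℕ) → κ} (hM : MultP p 1 κ c) (i : Fin 1)
    (τ : Fin 1 → κ) : mu p 1 κ (step p 1 κ i τ c) + p = mu p 1 κ c := by
  rw [mu_eq hM, mu_step_eq hM]
  have hlt := lt_ord hM
  omega

end SingleStepN1

open SingleStepN1 in
/-- **Stub S7: the curve case `n = 1` of the one-step Jacobian-colength drop.** For the height-one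
atom `z ^ p = a(u)` over a field of characteristic `p`, one point-blow-up step between states of
multiplicity `p` lowers `μ = dim_κ κ[[u]] ⧸ (∂a/∂u)` by at least (in fact exactly) `p = Δ_1(p)`:
with `m` the cleaned order (`p ≤ m`, `p ∤ m`), `μ(c) = m - 1` and `μ(step c) = m - p - 1`.
Only `MultP c` is used. [folklore] -/
theorem stub_singleStepN1 :
    ∀ p : ℕ, p.Prime → ∀ (κ : Type) [Field κ] [CharP κ p] [PerfectField κ]
      (c : (Fin 1 → ℕ) → κ) (i : Fin 1) (τ : Fin 1 → κ),
      Isol p 1 κ c → MultP p 1 κ c → Isol p 1 κ (step p 1 κ i τ c) → MultP p 1 κ (step p 1 κ i τ c) →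
        mu p 1 κ (step p 1 κ i τ c) + p ≤ mu p 1 κ c := by
  intro p _ κ _ _ _ c i τ _ hM _ _
  exact (mu_step_add_eq hM i τ).le

end Summit.ResolutionOfSingularities.ResolutionOfSingularities.Theorems.JacobianBudget

end
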